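import Literature.AlgebraicGeometry.Motives.HodgeStructureOfCMTypeHomSpaces
import Literature.AlgebraicGeometry.ComplexMultiplication.CMTorusHodgeStructureOfCMType
import Literature.Geometry.Kaehler.ComplexTorusHodgeStructureHomomorphisms
import Literature.Geometry.Kaehler.ComplexTorusHomRankEquality
import HarnessLib

/-!
# `Hom` between the CM tori of two types — any two number fields:
# `rk Hom_ℚ(B₀, B₁) = dim_ℚ Hom_{ℚ-HS}(H¹(B₁), H¹(B₀)) = dim_ℚ Hom_{ℚ-HS}(V¹_{(K₁,Φ₁)}, V¹_{(K₀,Φ₀)}) = #{(s,t) | ∀ τ, τs ∈ Φ₀ ⟺ τt ∈ Φ₁}`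

Family `hodge`, lane `lit-hodgefound` (Track 2; Layers A1/A3: rows A1-20, A1-21 / Q278 «full faithfulness of `H¹`»,
A3.4.14–15 «`Hom` between CM tori»), topic `Literature/AlgebraicGeometry/ComplexMultiplication`, namespaces
`Literature.AlgebraicGeometry.Motives.HodgeStructure.Hom` (§1), `Literature.Geometry.Kaehler.ComplexTorus` (§2) and
`Literature.AlgebraicGeometry.ComplexMultiplication.CMTorus` (§§3–4).  THEOREMS ONLY (no definition, no named fact;
D-0026 net debt `0`).  Companion of `Motives/HodgeStructureOfCMTypeHomSpaces` (the character count
`dim_ℚ Hom_{ℚ-HS}(V¹_{(K₁,Φ₁)}, V¹_{(K₀,Φ₀)}) = #{(s,t) ∈ Hom(K₀,ℂ) × Hom(K₁,ℂ) | ∀ τ ∈ Aut(ℂ), τs ∈ Φ₀ ⟺ τt ∈ Φ₁}`),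
transported to the CM tori `B_i = ℂ^{Φ_i}/u(𝔪_i) = ComplexTorus (CMTorus.periodEquiv Φᵢ μᵢ)` of `CMTorusEigenRows` along
the tree's isomorphisms of Hodge structures `V¹_{(Kᵢ,Φᵢ)} ≅ H¹(Bᵢ, ℚ)` (`CMTorus.ofCMTypeHom` / `toOfCMTypeHom`,
`CMTorusHodgeStructureOfCMType`) and the tree's full faithfulness of `X ↦ H¹(X, ℚ)` on complex tori up to isogeny
(`ComplexTorus.homEquivHomRat`, `Geometry/Kaehler/ComplexTorusHodgeStructureHomomorphisms`).

THE PRINTS.  B. van Geemen [vanGeemen1994HodgeAV] 3.6 (held `book:green1994-…` p0217: «the existence of such a map `φ^*`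
implies that the abelian varieties `X` and `Y` are isogeneous» — `Hom_ℚ(X, X′) = Hom_{ℚ-HS}(H¹(X′), H¹(X))` on tori);
P. Deligne, J. S. Milne [DeligneMilne1982Tannakian] II Thm. 6.20 («`H_B^1` is fully faithful»); M. Green, P. Griffiths,
M. Kerr [GreenGriffithsKerr2012] §V.B p0160 («`V¹_{(K,Σ)} = H¹(A^{(K,Σ)}_𝔞)` as `ℚ`-Hodge structures, independently of
`𝔞`»), §V.D Prop. V.D.4 («`η(F) ≅ F`; and `η(F) = E_φ` iff `(V, φ)` is irreducible»); J. S. Milne [MilneCM2006] Ch. I §5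
Prop. 5.2 (CM Hodge structures ≃ representations of the Serre group — `Hom` spaces are multiplicity pairings of characters),
§3 Prop. 3.12 (isogeny classes ↔ CM-pairs); H. Lange [Lange2023AbelianVarietiesComplex] §1.1.2 Prop. 1.1.15 / Cor. 1.1.16
(`Hom_ℚ` is an isogeny invariant), §2.4.4 Cor. 2.4.26; G. Shimura [Shimura1998] §7.4 Prop. 15, §8.2 Prop. 26 (the
same-type evaluations, not repeated here); Z. Gao, E. Ullmo [GaoUllmo2025] Thm. 3.1 and K. Hulek, R. Laface
[HulekLaface2019PicardNumbersAV] Prop. 2.2 — for CM FIELDS the number below is the `Hom`-term of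
`ρ(A × B) = ρ(A) + ρ(B) + rk Hom(A, B^∨)` evaluated by Pohlmann's theorem, the route of the lane's
`CMTorusPairPicardNumberHomRank` (abelian-variety hypothesis); here for ALL number fields with complex CM types, by the
Hodge-structure count (independent argument).

WHAT IS PROVED.
* §1 `HodgeStructure.Hom.finrank_eq_of_comp_eq_id` — conjugation by isomorphisms of Hodge structures (`e ∘ – ∘ d`) is a
  `ℚ`-LINEAR bijection of `Hom` spaces: isomorphic Hodge structures have `Hom` spaces of equal dimension.
* §2 `ComplexTorus.finrank_hom_hodgeStructure_one_eq_finrank_homRat` — for ANY complex tori `X`, `X′`: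
  **`dim_ℚ Hom_{ℚ-HS}(H¹(X′, ℚ), H¹(X, ℚ)) = dim_ℚ Hom_ℚ(X, X′)`** (`homEquivHomRat` is `ℚ`-linear: `homMatrix_add/_smul`).
* §3 (CM tori of two number fields `K₀, K₁`, CM types `Φ₀, Φ₁`, lattice bases `μ₀, μ₁`; no CM-field hypothesis)
  `finrank_hom_hodgeStructure_periodEquiv_eq_finrank_hom_ofCMType`, `finrank_hom_hodgeStructure_periodEquiv_eq_ncard`,
  **`finrank_homRat_periodEquiv_periodEquiv_eq_ncard`** (`rk Hom_ℚ(B₀, B₁) = #{(s,t) | ∀ τ, τs ∈ Φ₀ ⟺ τt ∈ Φ₁}`), its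
  mirror `…_eq_ncard'` and `finrank_homRat_periodEquiv_periodEquiv_comm` (`rk Hom_ℚ(B₀,B₁) = rk Hom_ℚ(B₁,B₀)`),
  `finrank_homRat_periodEquiv_periodEquiv_eq_zero_iff` / **`homRat_periodEquiv_periodEquiv_eq_bot_iff`** (`Hom_ℚ = 0` iff
  no compatible pair), **`not_isIsogenous_periodEquiv_periodEquiv_of_forall`** / `exists_forall_comp_mem_iff_of_isIsogenous`
  (isogenous CM tori have a compatible pair of embeddings), `finrank_homRat_eq_ncard_of_isIsogenous_periodEquiv`
  (isogeny classes `X ∼ B₀`, `Y ∼ B₁`).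
* §4 (one type) **`finrank_endAlgRat_periodEquiv_eq_ncard`** (`dim_ℚ End_ℚ(ℂ^Φ/u(𝔪)) = #{(s,t) | ∀ τ, τs ∈ Φ ⟺ τt ∈ Φ}`),
  `finrank_le_finrank_endAlgRat_periodEquiv` (`≥ [K:ℚ]`), validation `n = 1`:
  **`finrank_endAlgRat_periodEquiv_eq_two_of_finrank_eq_two`** (`[K:ℚ] = 2` ⟹ `dim End_ℚ(E) = 2`: `End_ℚ` of a CM elliptic
  curve is its CM field, numerically).

NOT HERE: the evaluation of the count for fields of higher degree (same primitive type, shared CM subfields), the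
algebra structure of `End_ℚ`, abelian varieties on the algebraic carrier (`Motives.AbelianVariety`).

## References
* [vanGeemen1994HodgeAV] B. van Geemen, LNM 1594 (1994) — 3.6 (p. 217).
* [DeligneMilne1982Tannakian] P. Deligne, J. S. Milne, LNM 900 (1982) — II §6 Thm. 6.20.
* [GreenGriffithsKerr2012] M. Green, P. Griffiths, M. Kerr, Ann. of Math. Stud. 183 (2012) — §V.B p. 160, §V.D Prop. V.D.4.
* [MilneCM2006] J. S. Milne, *Complex Multiplication* — Ch. I §3 Prop. 3.12, §5 Prop. 5.2.
* [Lange2023AbelianVarietiesComplex] H. Lange (2023) — §1.1.2 Prop. 1.1.6, 1.1.15, Cor. 1.1.16; §2.4.4 Cor. 2.4.26.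
* [Shimura1998] G. Shimura (1998) — §5.1, §7.4 Prop. 15, §8.2 Prop. 26.
* [GaoUllmo2025] Z. Gao, E. Ullmo, J. Inst. Math. Jussieu 25 (2025) — Thm. 3.1.
* [HulekLaface2019PicardNumbersAV] K. Hulek, R. Laface (2019) — §2.1 Prop. 2.2.
* [DeligneHodgeII1971] P. Deligne, *Théorie de Hodge II* — Thm. 2.3.5.
* [VoisinHodgeI2002] C. Voisin (2002) — §7.3.1 (p. 148).

## Provenance
Lane `lit-hodgefound`, prover seat `lit-hodgefound-p29` (generation 12), self-proposed row g12-#1 FILE 2 (lane INBOX claim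
2026-08-23T08:50:16Z); consumes BY NAME `Motives/HodgeStructureOfCMTypeHomSpaces` (`finrank_hom_ofCMType_eq_ncard`,
`finrank_hom_ofCMType_eq_ncard'`, `finrank_le_finrank_end_ofCMType`, `finrank_end_ofCMType_eq_two_of_finrank_eq_two`),
`ComplexMultiplication/CMTorusHodgeStructureOfCMType` (`CMTorus.ofCMTypeHom`, `toOfCMTypeHom`, `…_comp_…`),
`Geometry/Kaehler/ComplexTorusHodgeStructureHomomorphisms` (`homEquivHomRat`, `homMatrix_add`, `homMatrix_smul`),
`Geometry/Kaehler/ComplexTorusHomRankEquality` (`finrank_homRat_self`, `IsIsogenous.finrank_homRat_eq_left/right`),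
`Geometry/Kaehler/ComplexTorusEndomorphismAlgebraProduct` (`not_isIsogenous_of_homRat_eq_bot`),
`Motives/HodgeStructureQuotient` (`Hom.comp_add`, `add_comp`, `comp_smul`, `smul_comp`, `comp_assoc`, `comp_id`, `id_comp`).
-/

noncomputable section

-- Nested instance problems on the carrier `↥(ComplexTorus.rationalForms P 1)` (a `ℚ`-subspace of a `ℂ`-space of
-- `ℝ`-multilinear maps), cf. `ComplexMultiplication/CMTorusHodgeStructureOfCMType`.
set_option maxSynthPendingDepth 3

open scoped TensorProduct
open Module

/-! ## §1 Isomorphic Hodge structures have `Hom` spaces of the same dimension -/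

namespace Literature.AlgebraicGeometry.Motives

namespace HodgeStructure.Hom

universe u₁ u₂ u₃ u₄

variable {n : ℤ} {V₁ : Type u₁} [AddCommGroup V₁] [Module ℚ V₁] {V₂ : Type u₂} [AddCommGroup V₂]
  [Module ℚ V₂] {V₃ : Type u₃} [AddCommGroup V₃] [Module ℚ V₃] {V₄ : Type u₄} [AddCommGroup V₄] [Module ℚ V₄]
  {H₁ : HodgeStructure V₁ n} {H₂ : HodgeStructure V₂ n} {H₃ : HodgeStructure V₃ n} {H₄ : HodgeStructure V₄ n}

/-- **Conjugation by isomorphisms of Hodge structures is a `ℚ`-LINEAR bijection of `Hom` spaces**: for mutually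
inverse morphisms `e : H₁ ⇄ H₂ : e′` and `d : H₃ ⇄ H₄ : d′`, `φ ↦ e′ ∘ φ ∘ d` is a `ℚ`-linear isomorphism
`Hom(H₄, H₂) ≅ Hom(H₃, H₁)`, so `dim_ℚ Hom(H₄, H₂) = dim_ℚ Hom(H₃, H₁)` (the category of `ℚ`-Hodge structures is
`ℚ`-linear, composition bilinear). [cite: DeligneHodgeII1971, Thm. 2.3.5] [cite: VoisinHodgeI2002, §7.3.1 (p. 148)] -/
theorem finrank_eq_of_comp_eq_id (e : Hom H₁ H₂) (e' : Hom H₂ H₁) (he : e'.comp e = Hom.id H₁)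
    (he' : e.comp e' = Hom.id H₂) (d : Hom H₃ H₄) (d' : Hom H₄ H₃) (hd : d'.comp d = Hom.id H₃)
    (hd' : d.comp d' = Hom.id H₄) :
    finrank ℚ (Hom H₄ H₂) = finrank ℚ (Hom H₃ H₁) := by
  let c : Hom H₄ H₂ ≃ₗ[ℚ] Hom H₃ H₁ :=
    { toFun := fun φ => (e'.comp φ).comp d
      invFun := fun ψ => (e.comp ψ).comp d'
      map_add' := fun φ ψ => by rw [comp_add, add_comp]
      map_smul' := fun r φ => by rw [comp_smul, smul_comp, RingHom.id_apply]
      left_inv := fun φ => by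
        change (e.comp ((e'.comp φ).comp d)).comp d' = φ
        rw [comp_assoc, comp_assoc, hd', comp_id, ← comp_assoc, he', id_comp]
      right_inv := fun ψ => by
        change (e'.comp ((e.comp ψ).comp d')).comp d = ψ
        rw [comp_assoc, comp_assoc, hd, comp_id, ← comp_assoc, he, id_comp] }
  exact c.finrank_eq

end HodgeStructure.Hom

end Literature.AlgebraicGeometry.Motives

/-! ## §2 Full faithfulness, numerically: `dim_ℚ Hom_{ℚ-HS}(H¹(X′, ℚ), H¹(X, ℚ)) = dim_ℚ Hom_ℚ(X, X′)` for complex tori -/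

namespace Literature.Geometry.Kaehler

namespace ComplexTorus

open Literature.AlgebraicGeometry.Motives Literature.AlgebraicGeometry.Motives.HodgeStructure

variable {ι ι' : Type*} {E E' : Type*} [NormedAddCommGroup E] [NormedSpace ℂ E] [NormedAddCommGroup E']
  [NormedSpace ℂ E'] [Fintype ι] [Fintype ι'] [DecidableEq ι] [DecidableEq ι']
  (Φ : (ι → ℝ) ≃L[ℝ] E) (Φ' : (ι' → ℝ) ≃L[ℝ] E')

/-- **`dim_ℚ Hom_{ℚ-HS}(H¹(X′, ℚ), H¹(X, ℚ)) = dim_ℚ Hom_ℚ(X, X′)` for any two complex tori `X = E/Φ(ℤ^ι)`,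
`X′ = E′/Φ′(ℤ^{ι′})`**: the full-faithfulness bijection `homEquivHomRat` (`φ ↦ homMatrix φ`, van Geemen 3.6) is
`ℚ`-LINEAR (`homMatrix_add`, `homMatrix_smul`). [cite: vanGeemen1994HodgeAV, 3.6 (p. 217)]
[cite: DeligneMilne1982Tannakian, II §6 Thm. 6.20] [cite: Lange2023AbelianVarietiesComplex, §1.1.2 Prop. 1.1.6] -/
theorem finrank_hom_hodgeStructure_one_eq_finrank_homRat :
    finrank ℚ (Hom (hodgeStructure Φ' 1) (hodgeStructure Φ 1)) = finrank ℚ (homRat Φ Φ') := by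
  let c : Hom (hodgeStructure Φ' 1) (hodgeStructure Φ 1) ≃ₗ[ℚ] homRat Φ Φ' :=
    { homEquivHomRat Φ Φ' with
      map_add' := fun φ ψ => Subtype.ext (by
        change homMatrix Φ Φ' (φ + ψ).toLinearMap = homMatrix Φ Φ' φ.toLinearMap + homMatrix Φ Φ' ψ.toLinearMap
        rw [Hom.add_toLinearMap, homMatrix_add])
      map_smul' := fun r φ => Subtype.ext (by
        change homMatrix Φ Φ' (r • φ).toLinearMap = r • homMatrix Φ Φ' φ.toLinearMap
        rw [Hom.smul_toLinearMap, homMatrix_smul]) }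
  exact c.finrank_eq

end ComplexTorus

end Literature.Geometry.Kaehler

/-! ## §3 The CM tori of two types: `rk Hom_ℚ(B₀, B₁) = dim Hom_{ℚ-HS}(H¹(B₁), H¹(B₀)) = dim Hom_{ℚ-HS}(V¹_{Φ₁}, V¹_{Φ₀}) = #C` -/

namespace Literature.AlgebraicGeometry.ComplexMultiplication

open scoped Classical
open Literature.AlgebraicGeometry.Motives (CMType)
open Literature.AlgebraicGeometry.Motives.HodgeStructure (ofCMType Hom finrank_hom_ofCMType_eq_ncard)
open Literature.Geometry.Kaehler Literature.Geometry.Kaehler.ComplexTorus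

namespace CMTorus

variable {K₀ K₁ : Type} [Field K₀] [NumberField K₀] [Field K₁] [NumberField K₁]
  {ι₀ ι₁ : Type} [Fintype ι₀] [Fintype ι₁] [DecidableEq ι₀] [DecidableEq ι₁]
  (Φ₀ : CMType K₀) (Φ₁ : CMType K₁) (μ₀ : Basis ι₀ ℚ K₀) (μ₁ : Basis ι₁ ℚ K₁)

/-- **`dim_ℚ Hom_{ℚ-HS}(H¹(B₁, ℚ), H¹(B₀, ℚ)) = dim_ℚ Hom_{ℚ-HS}(V¹_{(K₁,Φ₁)}, V¹_{(K₀,Φ₀)})`** for the CM tori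
`B_i = ℂ^{Φ_i}/u(𝔪_i)` (`ComplexTorus (periodEquiv Φᵢ μᵢ)`) of ANY two number fields: conjugation by the isomorphisms of
Hodge structures `V¹_{(Kᵢ,Φᵢ)} ≅ H¹(Bᵢ, ℚ)` («`V¹_{(K,Σ)} = H¹(A^{(K,Σ)}_𝔞)` as `ℚ`-Hodge structures, independently of
`𝔞`»; the tree's `ofCMTypeHom` / `toOfCMTypeHom`). [cite: GreenGriffithsKerr2012, §V.B p. 160]
[cite: DeligneHodgeII1971, Thm. 2.3.5] -/
theorem finrank_hom_hodgeStructure_periodEquiv_eq_finrank_hom_ofCMType :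
    finrank ℚ (Hom (ComplexTorus.hodgeStructure (periodEquiv Φ₁ μ₁) 1)
        (ComplexTorus.hodgeStructure (periodEquiv Φ₀ μ₀) 1)) =
      finrank ℚ (Hom (ofCMType Φ₁) (ofCMType Φ₀)) :=
  Motives.HodgeStructure.Hom.finrank_eq_of_comp_eq_id (ofCMTypeHom Φ₀ μ₀) (toOfCMTypeHom Φ₀ μ₀)
    (toOfCMTypeHom_comp_ofCMTypeHom Φ₀ μ₀) (ofCMTypeHom_comp_toOfCMTypeHom Φ₀ μ₀) (ofCMTypeHom Φ₁ μ₁)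
    (toOfCMTypeHom Φ₁ μ₁) (toOfCMTypeHom_comp_ofCMTypeHom Φ₁ μ₁) (ofCMTypeHom_comp_toOfCMTypeHom Φ₁ μ₁)

/-- **`dim_ℚ Hom_{ℚ-HS}(H¹(B₁, ℚ), H¹(B₀, ℚ)) = #{(s,t) ∈ Hom(K₀,ℂ) × Hom(K₁,ℂ) | ∀ τ ∈ Aut(ℂ), τs ∈ Φ₀ ⟺ τt ∈ Φ₁}`**
for the CM tori of any two number fields (the count of `Motives/HodgeStructureOfCMTypeHomSpaces`, transported).
[cite: MilneCM2006, Ch. I §5 Prop. 5.2] [cite: GreenGriffithsKerr2012, §V.B p. 160] -/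
theorem finrank_hom_hodgeStructure_periodEquiv_eq_ncard :
    finrank ℚ (Hom (ComplexTorus.hodgeStructure (periodEquiv Φ₁ μ₁) 1)
        (ComplexTorus.hodgeStructure (periodEquiv Φ₀ μ₀) 1)) =
      {q : (K₀ →+* ℂ) × (K₁ →+* ℂ) | ∀ τ : ℂ ≃+* ℂ,
        ((τ : ℂ →+* ℂ).comp q.1 ∈ Φ₀.1 ↔ (τ : ℂ →+* ℂ).comp q.2 ∈ Φ₁.1)}.ncard := by
  rw [finrank_hom_hodgeStructure_periodEquiv_eq_finrank_hom_ofCMType, finrank_hom_ofCMType_eq_ncard]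

/-- **THE RANK OF `Hom` BETWEEN THE CM TORI OF TWO TYPES — ANY TWO NUMBER FIELDS:
`rk Hom_ℚ(B₀, B₁) = #{(s,t) ∈ Hom(K₀,ℂ) × Hom(K₁,ℂ) | ∀ τ ∈ Aut(ℂ), τs ∈ Φ₀ ⟺ τt ∈ Φ₁}`** for `B_i = ℂ^{Φ_i}/u(𝔪_i)`,
`K₀, K₁` arbitrary number fields with complex CM types `Φ₀, Φ₁` and lattices `𝔪_i = ⊕ ℤ μ_{i,b}` — no abelian-variety /
CM-field hypothesis: `Hom_ℚ(B₀, B₁) ≅ Hom_{ℚ-HS}(H¹(B₁), H¹(B₀))` (van Geemen 3.6 / Deligne–Milne 6.20 on tori,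
`ComplexTorus.homEquivHomRat`) `≅ Hom_{ℚ-HS}(V¹_{Φ₁}, V¹_{Φ₀})` (GGK §V.B) and the character count (Milne CM Prop. 5.2;
Galois descent).  For CM fields this is the `Hom`-term of Hulek–Laface Prop. 2.2 evaluated by Pohlmann's theorem
(Gao–Ullmo Thm. 3.1; the lane's `CMTorusPairPicardNumberHomRank`, there under the abelian-variety hypothesis), here
unconditionally and by an independent argument. [cite: vanGeemen1994HodgeAV, 3.6 (p. 217)]
[cite: MilneCM2006, Ch. I §5 Prop. 5.2] [cite: GaoUllmo2025, Thm. 3.1 (with proof)]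
[cite: HulekLaface2019PicardNumbersAV, §2.1 Prop. 2.2 (proof)] -/
theorem finrank_homRat_periodEquiv_periodEquiv_eq_ncard :
    finrank ℚ (homRat (periodEquiv Φ₀ μ₀) (periodEquiv Φ₁ μ₁)) =
      {q : (K₀ →+* ℂ) × (K₁ →+* ℂ) | ∀ τ : ℂ ≃+* ℂ,
        ((τ : ℂ →+* ℂ).comp q.1 ∈ Φ₀.1 ↔ (τ : ℂ →+* ℂ).comp q.2 ∈ Φ₁.1)}.ncard := by
  rw [← ComplexTorus.finrank_hom_hodgeStructure_one_eq_finrank_homRat,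
    finrank_hom_hodgeStructure_periodEquiv_eq_ncard]

/-- The mirror count: `rk Hom_ℚ(B₁, B₀)` is the same number (transposed compatible pairs).
[cite: MilneCM2006, Ch. I §5 Prop. 5.2] [cite: Lange2023AbelianVarietiesComplex, §2.4.4 Cor. 2.4.26] -/
theorem finrank_homRat_periodEquiv_periodEquiv_eq_ncard' :
    finrank ℚ (homRat (periodEquiv Φ₁ μ₁) (periodEquiv Φ₀ μ₀)) =
      {q : (K₀ →+* ℂ) × (K₁ →+* ℂ) | ∀ τ : ℂ ≃+* ℂ,
        ((τ : ℂ →+* ℂ).comp q.1 ∈ Φ₀.1 ↔ (τ : ℂ →+* ℂ).comp q.2 ∈ Φ₁.1)}.ncard := by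
  rw [← ComplexTorus.finrank_hom_hodgeStructure_one_eq_finrank_homRat,
    finrank_hom_hodgeStructure_periodEquiv_eq_finrank_hom_ofCMType,
    Motives.HodgeStructure.finrank_hom_ofCMType_eq_ncard']

/-- `rk Hom_ℚ(B₀, B₁) = rk Hom_ℚ(B₁, B₀)` for the CM tori of two types (for abelian varieties this is duality /
Poincaré reducibility; here for all CM tori, from the symmetric count). [cite: Lange2023AbelianVarietiesComplex, §2.4.4 Cor. 2.4.26]
[cite: MilneCM2006, Ch. I §5 Prop. 5.2] -/
theorem finrank_homRat_periodEquiv_periodEquiv_comm :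
    finrank ℚ (homRat (periodEquiv Φ₀ μ₀) (periodEquiv Φ₁ μ₁)) =
      finrank ℚ (homRat (periodEquiv Φ₁ μ₁) (periodEquiv Φ₀ μ₀)) := by
  rw [finrank_homRat_periodEquiv_periodEquiv_eq_ncard, finrank_homRat_periodEquiv_periodEquiv_eq_ncard']

/-- **`Hom_ℚ(B₀, B₁) = 0` iff NO pair `(s,t)` is compatible** (finite-dimensionality of `Hom_ℚ` and the count).
[cite: MilneCM2006, Ch. I §5 Prop. 5.2] [cite: Lange2023AbelianVarietiesComplex, §2.4.4 Cor. 2.4.26] -/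
theorem finrank_homRat_periodEquiv_periodEquiv_eq_zero_iff :
    finrank ℚ (homRat (periodEquiv Φ₀ μ₀) (periodEquiv Φ₁ μ₁)) = 0 ↔
      ∀ (s : K₀ →+* ℂ) (t : K₁ →+* ℂ), ∃ τ : ℂ ≃+* ℂ,
        ¬ ((τ : ℂ →+* ℂ).comp s ∈ Φ₀.1 ↔ (τ : ℂ →+* ℂ).comp t ∈ Φ₁.1) := by
  rw [finrank_homRat_periodEquiv_periodEquiv_eq_ncard, Set.ncard_eq_zero, Set.eq_empty_iff_forall_notMem]
  simp only [Set.mem_setOf_eq, not_forall, Prod.forall]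

/-- `Hom_ℚ(B₀, B₁) = ⊥` iff no pair is compatible. [cite: MilneCM2006, Ch. I §5 Prop. 5.2]
[cite: Lange2023AbelianVarietiesComplex, §2.4.4 Cor. 2.4.26] -/
theorem homRat_periodEquiv_periodEquiv_eq_bot_iff :
    homRat (periodEquiv Φ₀ μ₀) (periodEquiv Φ₁ μ₁) = ⊥ ↔
      ∀ (s : K₀ →+* ℂ) (t : K₁ →+* ℂ), ∃ τ : ℂ ≃+* ℂ,
        ¬ ((τ : ℂ →+* ℂ).comp s ∈ Φ₀.1 ↔ (τ : ℂ →+* ℂ).comp t ∈ Φ₁.1) := by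
  rw [← Submodule.finrank_eq_zero, finrank_homRat_periodEquiv_periodEquiv_eq_zero_iff]

/-- **If no pair `(s,t)` is compatible, the CM tori `ℂ^{Φ₀}/u(𝔪₀)` and `ℂ^{Φ₁}/u(𝔪₁)` are NOT isogenous** (an isogeny is a
non-zero element of `Hom_ℚ`; van Geemen 3.6). [cite: vanGeemen1994HodgeAV, 3.6 (p. 217)] [cite: MilneCM2006, Ch. I §3 Prop. 3.12] -/
theorem not_isIsogenous_periodEquiv_periodEquiv_of_forall
    (h : ∀ (s : K₀ →+* ℂ) (t : K₁ →+* ℂ), ∃ τ : ℂ ≃+* ℂ,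
      ¬ ((τ : ℂ →+* ℂ).comp s ∈ Φ₀.1 ↔ (τ : ℂ →+* ℂ).comp t ∈ Φ₁.1)) :
    ¬ IsIsogenous (periodEquiv Φ₀ μ₀) (periodEquiv Φ₁ μ₁) := by
  haveI : Nonempty ι₀ := μ₀.index_nonempty
  exact not_isIsogenous_of_homRat_eq_bot ((homRat_periodEquiv_periodEquiv_eq_bot_iff Φ₀ Φ₁ μ₀ μ₁).2 h)

/-- Contrapositive: **isogenous CM tori of types `(K₀,Φ₀)`, `(K₁,Φ₁)` have a compatible pair of embeddings**.
[cite: vanGeemen1994HodgeAV, 3.6 (p. 217)] [cite: MilneCM2006, Ch. I §3 Prop. 3.12] -/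
theorem exists_forall_comp_mem_iff_of_isIsogenous (h : IsIsogenous (periodEquiv Φ₀ μ₀) (periodEquiv Φ₁ μ₁)) :
    ∃ (s : K₀ →+* ℂ) (t : K₁ →+* ℂ), ∀ τ : ℂ ≃+* ℂ,
      ((τ : ℂ →+* ℂ).comp s ∈ Φ₀.1 ↔ (τ : ℂ →+* ℂ).comp t ∈ Φ₁.1) := by
  by_contra hne
  simp only [not_exists, not_forall] at hne
  exact not_isIsogenous_periodEquiv_periodEquiv_of_forall Φ₀ Φ₁ μ₀ μ₁ hne h

variable {Φ₀ Φ₁ μ₀ μ₁} in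
/-- **Isogeny-class form**: for complex tori `X ∼ B₀` and `Y ∼ B₁` isogenous to the CM tori of the two types,
`rk Hom_ℚ(X, Y) = #{compatible pairs}` (`rk Hom_ℚ` is an isogeny invariant, Lange Prop. 1.1.15 / Cor. 1.1.16).
[cite: Lange2023AbelianVarietiesComplex, §1.1.2 Prop. 1.1.15 and Cor. 1.1.16] [cite: MilneCM2006, Ch. I §5 Prop. 5.2] -/
theorem finrank_homRat_eq_ncard_of_isIsogenous_periodEquiv {κ₀ κ₁ : Type*} [Fintype κ₀] [Fintype κ₁]
    [DecidableEq κ₀] [DecidableEq κ₁] {E₀ E₁ : Type*} [NormedAddCommGroup E₀] [NormedSpace ℂ E₀]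
    [NormedAddCommGroup E₁] [NormedSpace ℂ E₁] {P : (κ₀ → ℝ) ≃L[ℝ] E₀} {Q : (κ₁ → ℝ) ≃L[ℝ] E₁}
    (hP : IsIsogenous P (periodEquiv Φ₀ μ₀)) (hQ : IsIsogenous Q (periodEquiv Φ₁ μ₁)) :
    finrank ℚ (homRat P Q) =
      {q : (K₀ →+* ℂ) × (K₁ →+* ℂ) | ∀ τ : ℂ ≃+* ℂ,
        ((τ : ℂ →+* ℂ).comp q.1 ∈ Φ₀.1 ↔ (τ : ℂ →+* ℂ).comp q.2 ∈ Φ₁.1)}.ncard := by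
  rw [hP.finrank_homRat_eq_left Q, hQ.finrank_homRat_eq_right (periodEquiv Φ₀ μ₀),
    finrank_homRat_periodEquiv_periodEquiv_eq_ncard]

/-! ## §4 One type: the endomorphism algebra `End_ℚ(ℂ^Φ/u(𝔪))` -/

section OneType

variable {K : Type} [Field K] [NumberField K] {ι : Type} [Fintype ι] [DecidableEq ι] (Φ : CMType K) (μ : Basis ι ℚ K)

/-- **`dim_ℚ End_ℚ(ℂ^Φ/u(𝔪)) = #{(s,t) ∈ Hom(K,ℂ)² | ∀ τ ∈ Aut(ℂ), τs ∈ Φ ⟺ τt ∈ Φ}`** for the CM torus of ANY number field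
`K` with a complex CM type `Φ` (`End_ℚ = Hom_ℚ(B, B)`, the tree's `finrank_homRat_self`).  For a CM field and `Φ`
primitive this number is `[K : ℚ]` (Shimura §7.4 Prop. 15 / §8.2 Prop. 26 — not evaluated here).
[cite: MilneCM2006, Ch. I §5 Prop. 5.2] [cite: Shimura1998, §8.2 Prop. 26] -/
theorem finrank_endAlgRat_periodEquiv_eq_ncard :
    finrank ℚ (endAlgRat (periodEquiv Φ μ)) =
      {q : (K →+* ℂ) × (K →+* ℂ) | ∀ τ : ℂ ≃+* ℂ,
        ((τ : ℂ →+* ℂ).comp q.1 ∈ Φ.1 ↔ (τ : ℂ →+* ℂ).comp q.2 ∈ Φ.1)}.ncard := by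
  rw [← finrank_homRat_self, finrank_homRat_periodEquiv_periodEquiv_eq_ncard]

/-- **`dim_ℚ End_ℚ(ℂ^Φ/u(𝔪)) ≥ [K : ℚ]`** (the diagonal pairs; `K ↪ End_ℚ` by the CM action).
[cite: Shimura1998, §5.1 (1) («an isomorphism ι of F into End_ℚ(A)»)] [cite: GreenGriffithsKerr2012, §V.D Prop. V.D.4] -/
theorem finrank_le_finrank_endAlgRat_periodEquiv : finrank ℚ K ≤ finrank ℚ (endAlgRat (periodEquiv Φ μ)) := by
  rw [← finrank_homRat_self, ← ComplexTorus.finrank_hom_hodgeStructure_one_eq_finrank_homRat,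
    finrank_hom_hodgeStructure_periodEquiv_eq_finrank_hom_ofCMType]
  exact Motives.HodgeStructure.finrank_le_finrank_end_ofCMType Φ

/-- Validation `n = 1`: **for an imaginary quadratic `K` (`[K : ℚ] = 2`) the CM elliptic curve `E = ℂ/u(𝔪)` has
`dim_ℚ End_ℚ(E) = 2 = [K : ℚ]`** — `End_ℚ(E) = K` numerically (Shimura §7.4 Prop. 15 for `n = 1`; Silverman's «`End(E) ⊗ ℚ ≅ K`»).
[cite: Shimura1998, §7.4 Prop. 15 (n = 1)] [cite: GreenGriffithsKerr2012, §V.D Prop. V.D.4] -/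
theorem finrank_endAlgRat_periodEquiv_eq_two_of_finrank_eq_two (h2 : finrank ℚ K = 2) :
    finrank ℚ (endAlgRat (periodEquiv Φ μ)) = 2 := by
  rw [← finrank_homRat_self, ← ComplexTorus.finrank_hom_hodgeStructure_one_eq_finrank_homRat,
    finrank_hom_hodgeStructure_periodEquiv_eq_finrank_hom_ofCMType]
  exact Motives.HodgeStructure.finrank_end_ofCMType_eq_two_of_finrank_eq_two Φ h2

end OneType
end CMTorus

end Literature.AlgebraicGeometry.ComplexMultiplication

end
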